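import Literature.Barriers.CriticalPhenomena.PlaquetteWalkHoleRootCutMarking
import HarnessLib

/-!
# Barrier catalogue (SAWScalingLimit): THE MARKING LAW, EDGE FORM — the kill-row edge dead from EITHER side: `K_S1` or `rootSS`,
`K_S2` or `farSWS`; LAW L's corner kills and the shut-row kills are one statement

Leaf of `PlaquetteWalkHoleRootCutMarking` (the marking law; the `K_S1` / `K_S2` kills for general domains with the kill CELL absent).
The cut law sees EDGES, not cells: the edge below the eastern pocket (`killSE.W`, between `rootSS = (w.1, w.2 − 2)` and
`killSE = (w.1 + 1, w.2 − 2)`) is dead as soon as EITHER of its two faces is absent, and likewise the edge below the far cell's column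
(`killSW.E`, between `killSW = (w.1 − 3, w.2 − 2)` and `farSWS = (w.1 − 2, w.2 − 2)`). So the lane's SHUT-ROW kills
(`PlaquetteWalkHoleRootShutRowEast`: `rootSS` absent ⇒ `w₁`-kill of the under route; `PlaquetteWalkHoleRootShutRow`: the cell below the
far cell's southern neighbour) and LAW L's corner kills are the SAME theorem. This file restates the parent's §4 with dead-edge
hypotheses: ★★★★★ `ΩG.kindsIn_rootS_eq_of_AJ_ne_zero_under_seColumnShut` (column form, floor), ★★★★★
`ΩG.kindsIn_rootS_eq_of_AJ_ne_zero_under_seCornerShut_eastWall` (east wall: `killSE.W` and `killSE.S` each dead from either side),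
★★★★★ `ΩG.kindsIn_farSW_eq_of_AJ_ne_zero_under_swColumnShut` (column form), with wound forms (either orientation) and the box
corollaries for ANY further defects: `lawL_box_rootSS_h2_under_w1_killed` (two rows below the hole, `rootSS = (h.1 + 1, 0)` removed ⇒
`w₁`-kill — the ShutRowEast cell, any width, any `S`), `lawL_box_farSWS_h2_under_w2_killed` (`farSWS = (h.1 − 1, 0)` removed ⇒ `w₂`-kill).

Not in print; venture lane «pcv-sawmu», seat b-step0 gen 29 (FINDING-YB-KILL-FORCED-ZEROS §28).

References: A. Glazman, I. Manolescu, arXiv:1708.00395v3, §1 (Fig. 1, Fig. 2, remark after eq. (1)), §2.1, Lemma 2.1 [GlazmanManolescu2019];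
A. Glazman, Electron. Commun. Probab. 20 (2015) no. 86, Lemma 3.1, proof pp. 6–7 [Glazman2015WeightedSAW]; R. Courant, H. Robbins, *What is
Mathematics?* (1941/1958), Ch. V Appendix §2 (the even–odd rule) [CourantRobbins1958]; L. V. Ahlfors, *Complex Analysis*, 3rd ed. (1979),
Ch. 4 §2.1 [AhlforsCA1979].
-/

noncomputable section

open Set Function Complex
open Literature.Topology.PlaneTopology

namespace Literature.Probability.RandomPlanarGeometry.SAW.YangBaxter

open Real

namespace ΩG

variable {D : Set Face} {w : Face}

/-! ## §1 The marking law with dead-edge hypotheses -/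

/-- ★★★★★ **THE SOUTH-EAST COLUMN SHUT FROM THE KILL ROW DOWN ⇒ EVERY WOUND UNDER-WALK DOUBLES `rootS` THROUGH ITS TWO `θ`-CORNERS**
(edge form of the parent's `…_killSE_column`: the kill-row edge `killSE.W` may be dead from EITHER side — `rootSS = (w.1, w.2 − 2)` absent
(the lane's `PlaquetteWalkHoleRootShutRowEast`) or `killSE w` absent (LAW L's `K_S1`)). Hole absent; for some floor row `Y ≤ w.2 − 2`, no face
below row `Y` and every west side of column `w.1 + 1` in the rows `Y, …, w.2 − 2` dead. Then `kindsIn (rootS w) = [corner, corner]` for every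
class-`B2a` under-walk whose excursion polygon winds around the root.
[cite: GlazmanManolescu2019, §1, Fig. 1 (two arcs at the two θ-corners weigh w₁), remark after eq. (1)]
[cite: Glazman2015WeightedSAW, Lemma 3.1 (proof, pp. 6–7)] [cite: CourantRobbins1958, Ch. V Appendix §2 (the even–odd rule)] -/
theorem kindsIn_rootS_eq_of_AJ_ne_zero_under_seColumnShut (hh : holeFaceW w ∉ D)
    (hKW : ((w.1, w.2 - 2) : Face) ∉ D ∨ killSE w ∉ D) {Y : ℤ}
    (hY : Y ≤ w.2 - 2) (hcol : ∀ y : ℤ, Y ≤ y → y ≤ w.2 - 3 → ((w.1, y) : Face) ∉ D ∨ ((w.1 + 1, y) : Face) ∉ D)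
    (hfloor : ∀ f : Face, f ∈ D → Y ≤ f.2)
    (ω : ΩG D (w.side .W) (farW w)) (hr : RootedFace D (w.side .W) (farW w)) (h : ω.IsB2a)
    (hS : ω.2.firstSideG = .S) (hA : ω.AJ hr h (toC (midPt (w.side .W))) ≠ 0) :
    ω.2.kindsIn (rootS w) = [.corner, .corner] := by
  set K : ℕ := (w.2 - Y).toNat + 1 with hKdef
  have hK1 : ((K - 1 : ℕ) : ℤ) = w.2 - Y := by rw [hKdef]; omega
  refine kindsIn_eq_corner_corner_of_twoLive_cut hh hr h hS
    (q := fun k => (w.1 + min (k : ℤ) 1, w.2 - ((k - 1 : ℕ) : ℤ)))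
    (c := fun k => if k = 0 then w else (w.1 + 1, w.2 - k)) (s := fun k => if k = 0 then Side.S else Side.W) (K := K)
    (by simp) (fun k hk => ?_) (fun k hk => ?_) (fun k hk => ?_) (Or.inr (Or.inr (Or.inl fun f hf => ?_)))
    (i := 0) (k := 1) zero_lt_one (fun k' hk' h0 h1' => ?_) (g := rootS w) (rootS_ne_farW w) (x := .N) (y := .E)
    (Or.inl ⟨rfl, rfl⟩) ?_ ?_ hA
  · -- the steps of the cut
    rcases Nat.eq_zero_or_pos k with rfl | hk1
    · simpa using segment_cornerPt_east ((w.1, w.2) : ℤ × ℤ)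
    · have e1 : ((k - 1 : ℕ) : ℤ) = k - 1 := by omega
      have e2 : ((k + 1 - 1 : ℕ) : ℤ) = k := by omega
      simp only [Nat.cast_add, Nat.cast_one, e1, e2, if_neg (show k ≠ 0 by omega),
        min_eq_right (show (1 : ℤ) ≤ k by exact_mod_cast hk1), min_eq_right (show (1 : ℤ) ≤ k + 1 by omega)]
      have := segment_cornerPt_south ((w.1 + 1, w.2 - (k - 1 : ℤ)) : ℤ × ℤ)
      simp only at this
      rw [show w.2 - ((k : ℤ) - 1) - 1 = w.2 - k by ring] at this
      exact this
  · rcases Nat.eq_zero_or_pos k with rfl | hk1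
    · obtain ⟨a, b⟩ := w; simp [holeFaceW, Face.side]
    · rw [if_neg (show k ≠ 0 by omega), if_neg (show k ≠ 0 by omega)]
      obtain ⟨a, b⟩ := w
      simp only [holeFaceW, Face.side, ne_eq, MidEdge.vert.injEq, not_and]
      intro h; omega
  · rcases Nat.eq_zero_or_pos k with rfl | hk1
    · obtain ⟨a, b⟩ := w; simp [Face.side]
    · rw [if_neg (show k ≠ 0 by omega), if_neg (show k ≠ 0 by omega)]
      obtain ⟨a, b⟩ := w
      simp only [Face.side, ne_eq, MidEdge.vert.injEq, not_and]
      intro h; omega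
  · have := hfloor f hf; simp only [hK1]; omega
  · -- the dead edges: `killSE.W` and the shut column below it
    have hk2 : 2 ≤ k' := by omega
    simp only [if_neg (show k' ≠ 0 by omega)]
    rcases eq_or_lt_of_le hk2 with e2 | h3
    · subst e2
      rcases hKW with hK | hK
      · left
        have e : ((w.1, w.2 - 2) : Face) = (w.1 + 1 - 1, w.2 - ((2 : ℕ) : ℤ)) := Prod.ext (by simp) (by simp)
        rw [e] at hK; simpa [Face.side, MidEdge.faces] using hK
      · right
        have e : killSE w = (w.1 + 1, w.2 - ((2 : ℕ) : ℤ)) := by obtain ⟨a, b⟩ := w; simp [killSE]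
        simpa [Face.side, MidEdge.faces, e] using hK
    · have hk'K : (k' : ℤ) ≤ w.2 - Y := by omega
      rcases hcol (w.2 - k') (by omega) (by omega) with hd | hd
      · left
        have e : ((w.1, w.2 - k') : Face) = (w.1 + 1 - 1, w.2 - k') := Prod.ext (by simp) rfl
        simpa [Face.side, MidEdge.faces, e] using hd
      · right; simpa [Face.side, MidEdge.faces] using hd
  · norm_num; exact root_side_S_eq_rootS_side_N w
  · norm_num; obtain ⟨a, b⟩ := w; simp [rootS, Face.side]

/-- ★★★★★ **THE SOUTH-EAST CORNER SHUT ON THE EAST WALL ⇒ EVERY WOUND UNDER-WALK DOUBLES `rootS` THROUGH ITS TWO `θ`-CORNERS** (edge form: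
the two edges `killSE.W`, `killSE.S` dead from either side — `killSE w` absent, or `rootSS` and `(w.1 + 1, w.2 − 3)` absent, or mixed — and
no face of `D` in the columns `≥ w.1 + 2`). [cite: GlazmanManolescu2019, §1, Fig. 1 (two arcs at the two θ-corners weigh w₁), remark after eq. (1)]
[cite: Glazman2015WeightedSAW, Lemma 3.1 (proof, pp. 6–7)] [cite: CourantRobbins1958, Ch. V Appendix §2 (the even–odd rule)] -/
theorem kindsIn_rootS_eq_of_AJ_ne_zero_under_seCornerShut_eastWall (hh : holeFaceW w ∉ D)
    (hKW : ((w.1, w.2 - 2) : Face) ∉ D ∨ killSE w ∉ D) (hKS : ((w.1 + 1, w.2 - 3) : Face) ∉ D ∨ killSE w ∉ D)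
    (heast : ∀ f : Face, f ∈ D → f.1 < w.1 + 2)
    (ω : ΩG D (w.side .W) (farW w)) (hr : RootedFace D (w.side .W) (farW w)) (h : ω.IsB2a)
    (hS : ω.2.firstSideG = .S) (hA : ω.AJ hr h (toC (midPt (w.side .W))) ≠ 0) :
    ω.2.kindsIn (rootS w) = [.corner, .corner] := by
  refine kindsIn_eq_corner_corner_of_twoLive_cut hh hr h hS
    (q := fun k => if k = 0 then (w.1, w.2) else if k = 1 then (w.1 + 1, w.2) else if k = 2 then (w.1 + 1, w.2 - 1)
      else if k = 3 then (w.1 + 1, w.2 - 2) else (w.1 + 2, w.2 - 2))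
    (c := fun k => if k = 0 then w else if k = 1 then (w.1 + 1, w.2 - 1) else (w.1 + 1, w.2 - 2))
    (s := fun k => if k = 0 ∨ k = 3 then Side.S else Side.W) (K := 4)
    (by simp) (fun k hk => ?_) (fun k hk => ?_) (fun k hk => ?_) (Or.inl fun f hf => ?_)
    (i := 0) (k := 1) zero_lt_one (fun k' hk' h0 h1' => ?_) (g := rootS w) (rootS_ne_farW w) (x := .N) (y := .E)
    (Or.inl ⟨rfl, rfl⟩) ?_ ?_ hA
  · interval_cases k
    · simpa using segment_cornerPt_east ((w.1, w.2) : ℤ × ℤ)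
    · simpa using segment_cornerPt_south ((w.1 + 1, w.2) : ℤ × ℤ)
    · have := segment_cornerPt_south ((w.1 + 1, w.2 - 1) : ℤ × ℤ)
      norm_num at this ⊢
      rw [show w.2 - 1 - 1 = w.2 - 2 by ring] at this
      exact this
    · have := segment_cornerPt_east ((w.1 + 1, w.2 - 2) : ℤ × ℤ)
      norm_num at this ⊢
      rw [show w.1 + 1 + 1 = w.1 + 2 by ring] at this
      exact this
  · interval_cases k <;> (obtain ⟨a, b⟩ := w; simp [holeFaceW, Face.side])
  · interval_cases k <;> (obtain ⟨a, b⟩ := w; simp [Face.side])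
  · have := heast f hf; norm_num; omega
  · have hk2 : k' = 2 ∨ k' = 3 := by omega
    rcases hk2 with rfl | rfl
    · rcases hKW with hK | hK
      · left
        norm_num [Face.side, MidEdge.faces]
        exact hK
      · right
        have e : killSE w = (w.1 + 1, w.2 - 2) := by obtain ⟨a, b⟩ := w; simp [killSE]
        norm_num [Face.side, MidEdge.faces]; rw [e] at hK; exact hK
    · rcases hKS with hK | hK
      · left
        norm_num [Face.side, MidEdge.faces]
        have e : ((w.1 + 1, w.2 - 3) : Face) = (w.1 + 1, w.2 - 2 - 1) := Prod.ext rfl (by simp only; ring)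
        rw [e] at hK; exact hK
      · right
        have e : killSE w = (w.1 + 1, w.2 - 2) := by obtain ⟨a, b⟩ := w; simp [killSE]
        norm_num [Face.side, MidEdge.faces]
        rw [e] at hK; exact hK
  · norm_num; exact root_side_S_eq_rootS_side_N w
  · norm_num; obtain ⟨a, b⟩ := w; simp [rootS, Face.side]

/-- ★★★★★ **THE FAR CELL'S COLUMN SHUT FROM THE KILL ROW DOWN ⇒ EVERY WOUND UNDER-WALK DOUBLES `farSW` THROUGH ITS TWO `(π − θ)`-CORNERS**
(edge form of the parent's `…_killSW_column`: the kill-row edge `killSW.E` dead from either side — `killSW w` absent (LAW L's `K_S2`) or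
`farSWS = (w.1 − 2, w.2 − 2)` absent (the lane's `PlaquetteWalkHoleRootShutRow` cell)). Hole absent; floor `Y ≤ w.2 − 2`, no face below it,
the west sides of column `w.1 − 2` dead in the rows `Y, …, w.2 − 2`. Then `kindsIn (farSW w) = [coCorner, coCorner]` for every class-`B2a`
under-walk whose excursion polygon winds around the root.
[cite: GlazmanManolescu2019, §1, Fig. 1 (two arcs at the two (π−θ)-corners weigh w₂), Fig. 2 («if θ = π/3, then w₂ = 0»)]
[cite: Glazman2015WeightedSAW, Lemma 3.1 (proof, pp. 6–7)] [cite: CourantRobbins1958, Ch. V Appendix §2 (the even–odd rule)] -/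
theorem kindsIn_farSW_eq_of_AJ_ne_zero_under_swColumnShut (hh : holeFaceW w ∉ D)
    (hKE : killSW w ∉ D ∨ ((w.1 - 2, w.2 - 2) : Face) ∉ D) {Y : ℤ}
    (hY : Y ≤ w.2 - 2) (hcol : ∀ y : ℤ, Y ≤ y → y ≤ w.2 - 3 → ((w.1 - 3, y) : Face) ∉ D ∨ ((w.1 - 2, y) : Face) ∉ D)
    (hfloor : ∀ f : Face, f ∈ D → Y ≤ f.2)
    (ω : ΩG D (w.side .W) (farW w)) (hr : RootedFace D (w.side .W) (farW w)) (h : ω.IsB2a)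
    (hS : ω.2.firstSideG = .S) (hA : ω.AJ hr h (toC (midPt (w.side .W))) ≠ 0) :
    ω.2.kindsIn (farSW w) = [.coCorner, .coCorner] := by
  set K : ℕ := (w.2 + 2 - Y).toNat with hKdef
  have hK4 : 4 ≤ K := by rw [hKdef]; omega
  have hKZ : (K : ℤ) = w.2 + 2 - Y := by rw [hKdef]; omega
  refine kindsIn_eq_coCorner_coCorner_of_twoLive_cut hh hr h hS
    (q := fun k => if k = 0 then (w.1, w.2) else if k = 1 then (w.1 - 1, w.2) else if k = 2 then (w.1 - 1, w.2 - 1)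
      else (w.1 - 2, w.2 + 2 - k))
    (c := fun k => if k = 0 then (w.1 - 1, w.2) else if k = 1 then (w.1 - 1, w.2 - 1) else if k = 2 then (w.1 - 2, w.2 - 1)
      else (w.1 - 2, w.2 + 1 - k))
    (s := fun k => if k = 0 ∨ k = 2 then Side.S else Side.W) (K := K)
    (by simp) (fun k hk => ?_) (fun k hk => ?_) (fun k hk => ?_) (Or.inr (Or.inr (Or.inl fun f hf => ?_)))
    (i := 1) (k := 2) one_lt_two (fun k' hk' h0 h1' => ?_) (g := farSW w) (farSW_ne_farW w) (x := .E) (y := .S)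
    (Or.inr (Or.inr (Or.inr ⟨rfl, rfl⟩))) ?_ ?_ hA
  · -- the steps of the cut
    rcases (by omega : k = 0 ∨ k = 1 ∨ k = 2 ∨ 3 ≤ k) with rfl | rfl | rfl | hk3
    · simpa using segment_cornerPt_west ((w.1, w.2) : ℤ × ℤ)
    · simpa using segment_cornerPt_south ((w.1 - 1, w.2) : ℤ × ℤ)
    · have := segment_cornerPt_west ((w.1 - 1, w.2 - 1) : ℤ × ℤ)
      norm_num at this ⊢
      rw [show w.1 - 1 - 1 = w.1 - 2 by ring] at this
      rw [show w.2 + 2 - 3 = w.2 - 1 by ring]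
      exact this
    · simp only [if_neg (show k ≠ 0 by omega), if_neg (show k ≠ 1 by omega), if_neg (show k ≠ 2 by omega),
        if_neg (show k + 1 ≠ 0 by omega), if_neg (show k + 1 ≠ 1 by omega), if_neg (show k + 1 ≠ 2 by omega),
        show ¬(k = 0 ∨ k = 2) by omega, Nat.cast_add, Nat.cast_one]
      have := segment_cornerPt_south ((w.1 - 2, w.2 + 2 - k) : ℤ × ℤ)
      simp only at this
      rw [show w.2 + 2 - (k : ℤ) - 1 = w.2 + 1 - k by ring] at this
      rw [show w.2 + 2 - ((k : ℤ) + 1) = w.2 + 1 - k by ring]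
      exact this
  · rcases (by omega : k = 0 ∨ k = 1 ∨ k = 2 ∨ 3 ≤ k) with rfl | rfl | rfl | hk3
    · obtain ⟨a, b⟩ := w; simp [holeFaceW, Face.side]
    · obtain ⟨a, b⟩ := w; simp [holeFaceW, Face.side]
    · obtain ⟨a, b⟩ := w; simp [holeFaceW, Face.side]
    · simp only [if_neg (show k ≠ 0 by omega), if_neg (show k ≠ 1 by omega), if_neg (show k ≠ 2 by omega),
        show ¬(k = 0 ∨ k = 2) by omega, if_false]
      obtain ⟨a, b⟩ := w; simp [holeFaceW, Face.side]
  · rcases (by omega : k = 0 ∨ k = 1 ∨ k = 2 ∨ 3 ≤ k) with rfl | rfl | rfl | hk3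
    · obtain ⟨a, b⟩ := w; simp [Face.side]
    · obtain ⟨a, b⟩ := w; simp [Face.side]
    · obtain ⟨a, b⟩ := w; simp [Face.side]
    · simp only [if_neg (show k ≠ 0 by omega), if_neg (show k ≠ 1 by omega), if_neg (show k ≠ 2 by omega),
        show ¬(k = 0 ∨ k = 2) by omega, if_false]
      obtain ⟨a, b⟩ := w; simp [Face.side]
  · have := hfloor f hf
    simp only [if_neg (show K ≠ 0 by omega), if_neg (show K ≠ 1 by omega), if_neg (show K ≠ 2 by omega), hKZ]
    omega
  · -- the dead edges: the hole's bottom, `killSW.E`, the shut column below it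
    rcases (by omega : k' = 0 ∨ k' = 3 ∨ 4 ≤ k') with rfl | rfl | hk4
    · right
      have e : holeFaceW w = (w.1 - 1, w.2) := by obtain ⟨a, b⟩ := w; simp [holeFaceW]
      simpa [Face.side, MidEdge.faces, e] using hh
    · rcases hKE with hK | hK
      · left
        have e : killSW w = (w.1 - 2 - 1, w.2 + 1 - ((3 : ℕ) : ℤ)) := Prod.ext (by simp [killSW]; ring) (by simp [killSW]; ring)
        norm_num [Face.side, MidEdge.faces]
        rw [e] at hK; norm_num at hK; exact hK
      · right
        have e : ((w.1 - 2, w.2 - 2) : Face) = (w.1 - 2, w.2 + 1 - ((3 : ℕ) : ℤ)) := Prod.ext rfl (by simp; ring)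
        norm_num [Face.side, MidEdge.faces]
        rw [e] at hK; norm_num at hK; exact hK
    · simp only [if_neg (show k' ≠ 0 by omega), if_neg (show k' ≠ 1 by omega), if_neg (show k' ≠ 2 by omega),
        show ¬(k' = 0 ∨ k' = 2) by omega, if_false]
      have hk'K : (k' : ℤ) ≤ w.2 + 1 - Y := by omega
      rcases hcol (w.2 + 1 - k') (by omega) (by omega) with hd | hd
      · left
        have e : ((w.1 - 3, w.2 + 1 - k') : Face) = (w.1 - 2 - 1, w.2 + 1 - k') := Prod.ext (by simp only; ring) rfl
        simpa [Face.side, MidEdge.faces, e] using hd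
      · right; simpa [Face.side, MidEdge.faces] using hd
  · norm_num; obtain ⟨a, b⟩ := w; simp [farSW, Face.side]; ring
  · norm_num; obtain ⟨a, b⟩ := w; simp [farSW, Face.side]

/-! ## §2 Wound forms, either orientation -/

/-- The reversed companion of a wound walk has the same kinds off the far cell: a `[κ, κ]` list transports.
[cite: GlazmanManolescu2019, §2.1 (walks and their reversals)] -/
private theorem kindsIn_eq_pair_of_rev_E (ω : ΩG D (w.side .W) (farW w)) (hr : RootedFace D (w.side .W) (farW w))
    (h : ω.IsB2a) {g : Face} (hg : g ≠ farW w) {κ : ArcKind} (hk : (ω.rev hr).2.kindsIn g = [κ, κ]) :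
    ω.2.kindsIn g = [κ, κ] := by
  have hperm := ω.kindsIn_rev_perm hr h hg
  rw [hk] at hperm
  have hp : (ω.2.kindsIn g).Perm (List.replicate 2 κ) := hperm.symm
  exact List.perm_replicate.1 hp

/-- ★★★★★ **South-east column shut from the kill row down ⇒ every WOUND under-walk is `w₁`-marked off the far cell** (either orientation).
[cite: GlazmanManolescu2019, §1 (remark after eq. (1)), Lemma 2.1] [cite: Glazman2015WeightedSAW, Lemma 3.1 (proof, pp. 6–7)]
[cite: CourantRobbins1958, Ch. V Appendix §2 (the even–odd rule)] -/
theorem not_W1FreeOff_farW_of_wound_under_seColumnShut (hh : holeFaceW w ∉ D)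
    (hKW : ((w.1, w.2 - 2) : Face) ∉ D ∨ killSE w ∉ D) {Y : ℤ} (hY : Y ≤ w.2 - 2)
    (hcol : ∀ y : ℤ, Y ≤ y → y ≤ w.2 - 3 → ((w.1, y) : Face) ∉ D ∨ ((w.1 + 1, y) : Face) ∉ D)
    (hfloor : ∀ f : Face, f ∈ D → Y ≤ f.2)
    (ω : ΩG D (w.side .W) (farW w)) (hr : RootedFace D (w.side .W) (farW w)) (h : ω.IsB2a)
    (hS : ω.2.firstSideG = .S) {θ : ℝ}
    (hW : ω.WE (fun _ => θ) ≠ excursionWinding θ ω.2.firstSideG (ω.z1 hr h) ω.1) : ¬ω.2.W1FreeOff (farW w) := by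
  have key : ω.2.kindsIn (rootS w) = [.corner, .corner] := by
    rcases ω.AJ_ne_zero_or_rev_of_wound hr h θ hW with hA | hA
    · exact kindsIn_rootS_eq_of_AJ_ne_zero_under_seColumnShut hh hKW hY hcol hfloor ω hr h hS hA
    · have h' := ω.rev_isB2a hr h
      have hS' : (ω.rev hr).2.firstSideG = .S := by rw [ω.rev_firstSide hr h]; exact hS
      exact kindsIn_eq_pair_of_rev_E ω hr h (rootS_ne_farW w)
        (kindsIn_rootS_eq_of_AJ_ne_zero_under_seColumnShut hh hKW hY hcol hfloor (ω.rev hr) hr h' hS' hA)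
  intro hfree
  have hmem : rootS w ∈ ω.2.facesVisited := by
    by_contra hn
    rw [YBWalk.kindsIn_eq_nil hn] at key
    exact List.cons_ne_nil _ _ key.symm
  exact hfree _ hmem (rootS_ne_farW w) key

/-- ★★★★★ **Far cell's column shut from the kill row down ⇒ every WOUND under-walk is `w₂`-marked off the far cell** (either orientation).
[cite: GlazmanManolescu2019, §1 (the paragraph of Fig. 2), Lemma 2.1] [cite: Glazman2015WeightedSAW, Lemma 3.1 (proof, pp. 6–7)]
[cite: CourantRobbins1958, Ch. V Appendix §2 (the even–odd rule)] -/
theorem not_W2FreeOff_farW_of_wound_under_swColumnShut (hh : holeFaceW w ∉ D)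
    (hKE : killSW w ∉ D ∨ ((w.1 - 2, w.2 - 2) : Face) ∉ D) {Y : ℤ} (hY : Y ≤ w.2 - 2)
    (hcol : ∀ y : ℤ, Y ≤ y → y ≤ w.2 - 3 → ((w.1 - 3, y) : Face) ∉ D ∨ ((w.1 - 2, y) : Face) ∉ D)
    (hfloor : ∀ f : Face, f ∈ D → Y ≤ f.2)
    (ω : ΩG D (w.side .W) (farW w)) (hr : RootedFace D (w.side .W) (farW w)) (h : ω.IsB2a)
    (hS : ω.2.firstSideG = .S) {θ : ℝ}
    (hW : ω.WE (fun _ => θ) ≠ excursionWinding θ ω.2.firstSideG (ω.z1 hr h) ω.1) : ¬ω.2.W2FreeOff (farW w) := by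
  have key : ω.2.kindsIn (farSW w) = [.coCorner, .coCorner] := by
    rcases ω.AJ_ne_zero_or_rev_of_wound hr h θ hW with hA | hA
    · exact kindsIn_farSW_eq_of_AJ_ne_zero_under_swColumnShut hh hKE hY hcol hfloor ω hr h hS hA
    · have h' := ω.rev_isB2a hr h
      have hS' : (ω.rev hr).2.firstSideG = .S := by rw [ω.rev_firstSide hr h]; exact hS
      exact kindsIn_eq_pair_of_rev_E ω hr h (farSW_ne_farW w)
        (kindsIn_farSW_eq_of_AJ_ne_zero_under_swColumnShut hh hKE hY hcol hfloor (ω.rev hr) hr h' hS' hA)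
  intro hfree
  have hmem : farSW w ∈ ω.2.facesVisited := by
    by_contra hn
    rw [YBWalk.kindsIn_eq_nil hn] at key
    exact List.cons_ne_nil _ _ key.symm
  exact hfree _ hmem (farSW_ne_farW w) key

end ΩG

end Literature.Probability.RandomPlanarGeometry.SAW.YangBaxter

namespace Literature.Barriers.CriticalPhenomena.PlaquetteWalk

open Literature.Probability.RandomPlanarGeometry.SAW.YangBaxter
open Real Complex

/-! ## §3 Boxes: the shut-row cells two rows below the hole kill their class whatever else is removed -/

section Boxes

variable {m n : ℕ} {S : List Face} {h : Face}

/-- ★★★★★ **ALL BOXES WITH TWO ROWS BELOW THE HOLE (`h.2 = 2`), ANY FURTHER DEFECTS: `rootSS = (h.1 + 1, 0)` REMOVED ⇒ THE UNDER ROUTE IS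
`w₁`-KILLED** (the lane's ShutRowEast cell: `Im VF(2π/3) > 0` there for `S = [h, rootSS]`; here the kill for every `S`).
[cite: GlazmanManolescu2019, §1 (remark after eq. (1)), Lemma 2.1]
[cite: Glazman2015WeightedSAW, Lemma 3.1 (proof, pp. 6–7)] [cite: CourantRobbins1958, Ch. V Appendix §2 (the even–odd rule)] -/
theorem lawL_box_rootSS_h2_under_w1_killed (hW : 1 ≤ h.1) (hE : h.1 ≤ m) (hS2 : h.2 = 2) (hN : 3 ≤ n)
    (hh : h ∈ S) (hfS : ((h.1 - 1, h.2) : Face) ∉ S) (hcR : ((h.1 + 1, 0) : Face) ∈ S) (θ : ℝ) :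
    ∀ (ω : ΩG (dom (boxMinus m n S)) (Face.side (h.1 + 1, h.2) .W) (farW (h.1 + 1, h.2))) (hb : ω.IsB2a),
      ω.2.firstSideG = .S →
      ω.WE (fun _ => θ) ≠ excursionWinding θ ω.2.firstSideG
        (ω.z1 (rootedFace_hroot_boxMinus_of_mem (farW_hroot_mem_boxMinus_of_not_mem hW hE (by omega) (by omega) hfS) hh)
          hb) ω.1 →
      ¬ω.2.W1FreeOff (farW (h.1 + 1, h.2)) := by
  intro ω hb hS' hW'
  have hhD : holeFaceW ((h.1 + 1, h.2) : Face) ∉ dom (boxMinus m n S) := by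
    rw [holeFaceW_hroot]; exact not_mem_dom_boxMinus_of_mem hh
  refine ΩG.not_W1FreeOff_farW_of_wound_under_seColumnShut hhD (Or.inl ?_) (Y := 0) (by simp only; omega)
    (fun y hy hy' => by simp only at hy'; omega) (fun f hf => (mem_dom_boxMinus.1 hf).1.2.2.1) ω _ hb hS' hW'
  have e : ((((h.1 + 1, h.2) : Face).1, ((h.1 + 1, h.2) : Face).2 - 2) : Face) = (h.1 + 1, 0) := Prod.ext rfl (by simp only; omega)
  rw [e]; exact not_mem_dom_boxMinus_of_mem hcR

/-- ★★★★★ **ALL BOXES WITH TWO ROWS BELOW THE HOLE (`h.2 = 2`), ANY FURTHER DEFECTS: `farSWS = (h.1 − 1, 0)` (the cell below the far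
cell's southern neighbour) REMOVED ⇒ THE UNDER ROUTE IS `w₂`-KILLED.** [cite: GlazmanManolescu2019, §1 (the paragraph of Fig. 2), Lemma 2.1]
[cite: Glazman2015WeightedSAW, Lemma 3.1 (proof, pp. 6–7)] [cite: CourantRobbins1958, Ch. V Appendix §2 (the even–odd rule)] -/
theorem lawL_box_farSWS_h2_under_w2_killed (hW : 1 ≤ h.1) (hE : h.1 ≤ m) (hS2 : h.2 = 2) (hN : 3 ≤ n)
    (hh : h ∈ S) (hfS : ((h.1 - 1, h.2) : Face) ∉ S) (hcF : ((h.1 - 1, 0) : Face) ∈ S) (θ : ℝ) :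
    ∀ (ω : ΩG (dom (boxMinus m n S)) (Face.side (h.1 + 1, h.2) .W) (farW (h.1 + 1, h.2))) (hb : ω.IsB2a),
      ω.2.firstSideG = .S →
      ω.WE (fun _ => θ) ≠ excursionWinding θ ω.2.firstSideG
        (ω.z1 (rootedFace_hroot_boxMinus_of_mem (farW_hroot_mem_boxMinus_of_not_mem hW hE (by omega) (by omega) hfS) hh)
          hb) ω.1 →
      ¬ω.2.W2FreeOff (farW (h.1 + 1, h.2)) := by
  intro ω hb hS' hW'
  have hhD : holeFaceW ((h.1 + 1, h.2) : Face) ∉ dom (boxMinus m n S) := by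
    rw [holeFaceW_hroot]; exact not_mem_dom_boxMinus_of_mem hh
  refine ΩG.not_W2FreeOff_farW_of_wound_under_swColumnShut hhD (Or.inr ?_) (Y := 0) (by simp only; omega)
    (fun y hy hy' => by simp only at hy'; omega) (fun f hf => (mem_dom_boxMinus.1 hf).1.2.2.1) ω _ hb hS' hW'
  have e : ((((h.1 + 1, h.2) : Face).1 - 2, ((h.1 + 1, h.2) : Face).2 - 2) : Face) = (h.1 - 1, 0) :=
    Prod.ext (by simp only; ring) (by simp only; omega)
  rw [e]; exact not_mem_dom_boxMinus_of_mem hcF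

end Boxes

end Literature.Barriers.CriticalPhenomena.PlaquetteWalk
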